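import Mathlib
import Summits.Ventures.PercRepro2.Defs
import Summits.Ventures.PercRepro2.Independence
import Summits.Ventures.PercRepro2.Harris
import Summits.Ventures.PercRepro2.Graph
import Summits.Ventures.PercRepro2.Exploration
import Summits.Ventures.PercRepro2.Events
import Summits.Ventures.PercRepro2.FourFunctions
import Summits.Ventures.PercRepro2.Induced
import Summits.Ventures.PercRepro2.Frontier
import Summits.Ventures.PercRepro2.ObsIndependence
import Summits.Ventures.PercRepro2.BHK
import Summits.Ventures.PercRepro2.BHKEvents
import Summits.Ventures.PercRepro2.MultiSource
import Summits.Ventures.PercRepro2.OrderPreservation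
import Summits.Ventures.PercRepro2.SeedSet
import Summits.Ventures.PercRepro2.MultiSourceFun
import Summits.Ventures.PercRepro2.CrossRootT
import Summits.Ventures.PercRepro2.VdBKahn
import Summits.Ventures.PercRepro2.HullDefs
import Summits.Ventures.PercRepro2.R1Rung
import Summits.Ventures.PercRepro2.CC2Rung
import Summits.Ventures.PercRepro2.CCTRootEdge

/-!
# (CC-T) at the edges incident to the avoided set (blind cell PercRepro2, typer-1; mine-c g2
`MINE-C.md` §9.10 (ii), INBOX 2026-08-23T09:47:48Z; lead g11 ASSIGNMENTS v11.10 (3))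

For an edge `e = {t, w}` with `t ∈ T`: opening `e` keeps `s` avoiding `T` iff `s` avoided `T ∪ {w}`
before (`update_true_mem_avoidAll_iff_insert`, via `cluster_update_true_eq_of_not_touch`), and on
that event the cluster of `s` is unchanged; so the shifts are `≤ 0` (`shift_avoided_edge`, `vdBK`
with the avoided sets `T ∪ {w}` and `T`) and `ccT_of_shift_product` (from `CCTRootEdge`) gives
**`ccT_avoided_edge`**: `CC2 p ends e s A B T T` for every admissible `p`.
-/

namespace Summit.Ventures.PercRepro2

namespace CCT

variable {V : Type*} {E : Type*} [Fintype E] [DecidableEq E] {R : Type*} [Field R]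
  [LinearOrder R] [IsStrictOrderedRing R]

/-! ## (CC-T) at an edge incident to the avoided set -/

section Avoided

variable [Fintype V] [DecidableEq V] (p : E → R) (ends : E → Sym2 V) {e : E} {t w : V}

omit [Fintype E] [Fintype V] [DecidableEq V] [LinearOrder R] [IsStrictOrderedRing R] in
/-- If neither end of `e` lies in the closed-`e` cluster of `s`, opening `e` leaves it unchanged. -/
lemma cluster_update_true_eq_of_not_touch (hends : ends e = s(t, w)) (ω : Config E) (s : V)
    (ht : t ∉ cluster ends (Function.update ω e false) s)
    (hw : w ∉ cluster ends (Function.update ω e false) s) :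
    cluster ends (Function.update ω e true) s = cluster ends (Function.update ω e false) s := by
  refine cluster_eq_of_eqOn_touches (ω := Function.update ω e false) (fun e' he' => ?_) rfl
  have hne : e' ≠ e := by
    rintro rfl
    rcases he' with ⟨x, hx, y, hxy⟩
    rw [hends, Sym2.eq_iff] at hxy
    rcases hxy with ⟨rfl, rfl⟩ | ⟨rfl, rfl⟩
    · exact ht hx
    · exact hw hx
  rw [Function.update_of_ne hne, Function.update_of_ne hne]

omit [Fintype E] [Fintype V] [LinearOrder R] [IsStrictOrderedRing R] in
/-- After opening `e = {t, w}` with `t ∈ T`, `s` avoids `T` iff it avoided `T ∪ {w}` before. -/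
lemma update_true_mem_avoidAll_iff_insert (hends : ends e = s(t, w)) (ω : Config E) (s : V)
    {T : Finset V} (ht : t ∈ T) :
    Function.update ω e true ∈ avoidAll ends s T ↔
      Function.update ω e false ∈ avoidAll ends s (insert w T) := by
  have hle := update_false_le_update_true' ω e
  have htw : Conn ends (Function.update ω e true) t w := conn_of_openAdj ⟨e, by simp, hends⟩
  constructor
  · intro h x hx
    rw [Finset.mem_insert] at hx
    rcases hx with rfl | hx
    · intro hc
      exact h t ht (conn_trans (conn_mono hle hc) (conn_symm htw))
    · exact fun hc => h x hx (conn_mono hle hc)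
  · intro h x hx hc
    have ht' : t ∉ cluster ends (Function.update ω e false) s :=
      h t (Finset.mem_insert_of_mem ht)
    have hw' : w ∉ cluster ends (Function.update ω e false) s := h w (Finset.mem_insert_self w T)
    have := cluster_update_true_eq_of_not_touch ends hends ω s ht' hw'
    have hx' : x ∈ cluster ends (Function.update ω e true) s := hc
    rw [this] at hx'
    exact h x (Finset.mem_insert_of_mem hx) hx'

/-- **The shift lemma at an edge of the avoided set** (mine-c §9.10 (ii), cleared): for an
up-set `𝓤` and `e = {t, w}` with `t ∈ T`, `P₁(R ∩ {C(s) ∈ 𝓤}) · P₀(R) ≤ P₀(R ∩ {C(s) ∈ 𝓤}) · P₁(R)`. -/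
theorem shift_avoided_edge (hp : IsProbVec p) (hends : ends e = s(t, w)) (s : V) {T : Finset V}
    (ht : t ∈ T) (A : Finset V) :
    prob (Function.update p e 1) (avoidAll ends s T ∩ connAll ends s A) *
        prob (Function.update p e 0) (avoidAll ends s T) ≤
      prob (Function.update p e 0) (avoidAll ends s T ∩ connAll ends s A) *
        prob (Function.update p e 1) (avoidAll ends s T) := by
  have hp₀ : IsProbVec (Function.update p e 0) := hp.update e le_rfl zero_le_one
  -- the `p₁`-masses are `p₀`-masses with the avoided set enlarged by `w`
  have hP : prob (Function.update p e 1) (avoidAll ends s T) =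
      prob (Function.update p e 0) (avoidAll ends s (insert w T)) := by
    rw [prob_update_one_eq, prob_update_zero_eq]
    congr 1
    ext ω
    exact update_true_mem_avoidAll_iff_insert ends hends ω s ht
  have hF : prob (Function.update p e 1) (avoidAll ends s T ∩ connAll ends s A) =
      prob (Function.update p e 0) (avoidAll ends s (insert w T) ∩ connAll ends s A) := by
    rw [prob_update_one_eq, prob_update_zero_eq]
    congr 1
    ext ω
    simp only [Set.mem_setOf_eq, Set.mem_inter_iff]
    rw [update_true_mem_avoidAll_iff_insert ends hends ω s ht]
    constructor
    · rintro ⟨hR, hX⟩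
      refine ⟨hR, ?_⟩
      have := cluster_update_true_eq_of_not_touch ends hends ω s
        (hR t (Finset.mem_insert_of_mem ht)) (hR w (Finset.mem_insert_self w T))
      simp only [connAll, Set.mem_setOf_eq, ← mem_cluster] at hX ⊢
      rw [← this]
      exact hX
    · rintro ⟨hR, hX⟩
      refine ⟨hR, ?_⟩
      have := cluster_update_true_eq_of_not_touch ends hends ω s
        (hR t (Finset.mem_insert_of_mem ht)) (hR w (Finset.mem_insert_self w T))
      simp only [connAll, Set.mem_setOf_eq, ← mem_cluster] at hX ⊢
      rw [this]
      exact hX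
  rw [hP, hF]
  -- vdB–Kahn with the avoided sets `T ∪ {w}` and `T`
  have key := vdBK (Function.update p e 0) hp₀ ends s A ∅ (insert w T) T
  have h1 : connAll ends s (∅ : Finset V) = Set.univ := by
    ext ω; simp [connAll]
  have h2 : insert w T ∩ T = T := by
    ext x; simp only [Finset.mem_inter, Finset.mem_insert]; tauto
  have h3 : insert w T ∪ T = insert w T := by
    ext x; simp only [Finset.mem_union, Finset.mem_insert]; tauto
  rw [h1, Set.univ_inter, Finset.union_empty, h2, h3, Set.inter_comm (connAll ends s A),
    Set.inter_comm (connAll ends s A)] at key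
  exact key

/-- **(CC-T) at every edge incident to the avoided set** (mine-c §9.10 (ii)): for `e = {t, w}`
with `t ∈ T`, `CC2 p ends e s A B T T` holds for every admissible `p`. -/
theorem ccT_avoided_edge (hp : IsProbVec p) (hends : ends e = s(t, w)) (s : V) {T : Finset V}
    (ht : t ∈ T) (A B : Finset V) : TwoSetRung.CC2 p ends e s A B T T := by
  refine ccT_of_shift_product p ends hp e s A B T ?_
  have hA := shift_avoided_edge p ends hp hends s ht A
  have hB := shift_avoided_edge p ends hp hends s ht B
  exact mul_nonneg_of_nonpos_of_nonpos (by linarith) (by linarith)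

end Avoided

end CCT

end Summit.Ventures.PercRepro2
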